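import Summits.KontsevichZagierPeriods.KontsevichZagierPeriods.Theses.SymplecticScissors
import Summits.KontsevichZagierPeriods.KontsevichZagierPeriods.Theorems.PlanarK0Injective.Negative.Kit
import Literature.NumberTheory.Transcendental.KZSemialgebraicComplex
import Literature.NumberTheory.Transcendental.KZSemiCanonicalReductionProofs

/-!
# `PlanarK0Injective` (stmt-KontsevichZagierPeriods-9847) — line `mordell-weil-normal-form`,
stub `stub_logCellLaw` (rung 0 of the normal form: the group law of logarithmic cells)

For real algebraic `a, b > 1` write `L(x) = {1 < u < x, 0 < v, u v < 1}` for the logarithmic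
cell under the hyperbola (area `log x`). **The functional equation `log (ab) = log a + log b` is
planar cut-and-paste**: `[L(ab)] − [L(a)] − [L(b)]` lies in the planar set-chain group, by one
vertical cut of `L(ab)` at `u = a` (rule 1a, plus the null segment `u = a`) and ONE rule-2 move,
the hyperbolic dilation `(u, v) ↦ (u / a, a v)` (`|det| = 1`, rational in the algebraic
parameter `a`), carrying `{a < u < ab, 0 < v, uv < 1}` onto `L(b)`. This is the multiplicative
relation of the toric normal basis of the line (card `Ideas/mordell-weil-normal-form.md`, rung 0:
log cells over a multiplicative basis), used by `stub_mordellWeilNormalForm`.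

Sources: Kontsevich–Zagier 2001, §1.1 (`log 2 = ∫₁² dx/x`), §1.2 rules (1a), (2).
-/

noncomputable section

open MeasureTheory Set MvPolynomial
open Literature.NumberTheory.Transcendental Literature.ModelTheory.ExponentialFields
open Summit.KontsevichZagierPeriods.SymplecticScissors.PlanarK0InjectiveNegative (planarGroup
  planarGens of_mem_planarGroup_of_volume_eq_zero of_sub_of_mem_planarGroup_of_domain_eq)

namespace Summit.KontsevichZagierPeriods.SymplecticScissors.MordellWeil

/-! ## The logarithmic cells and the auxiliary pieces -/

/-- `{q | q i < c}` is `ℚ`-semialgebraic for real algebraic `c`. [folklore] -/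
theorem isSemialgebraic_apply_lt_of_isAlgebraic {c : ℝ} (hc : IsAlgebraic ℚ c) (i : Fin 2) :
    IsSemialgebraic ℚ {q : Fin 2 → ℝ | q i < c} := by
  have h1 : IsSemialgebraicFunOn ℚ (univ : Set (Fin 2 → ℝ)) (fun q => q i) := by
    simpa using isSemialgebraicFunOn_aeval (isSemialgebraic_univ (k := ℚ)) (X i : MvPolynomial (Fin 2) ℚ)
  have h := (IsSemialgebraicFunOn.sub_holds h1
    (isSemialgebraicFunOn_const_of_isAlgebraic isSemialgebraic_univ hc)).isSemialgebraic_sep_neg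
  convert h using 1
  ext q
  simp [sub_neg]

/-- `{q | c < q i}` is `ℚ`-semialgebraic for real algebraic `c`. [folklore] -/
theorem isSemialgebraic_lt_apply_of_isAlgebraic {c : ℝ} (hc : IsAlgebraic ℚ c) (i : Fin 2) :
    IsSemialgebraic ℚ {q : Fin 2 → ℝ | c < q i} := by
  have h1 : IsSemialgebraicFunOn ℚ (univ : Set (Fin 2 → ℝ)) (fun q => q i) := by
    simpa using isSemialgebraicFunOn_aeval (isSemialgebraic_univ (k := ℚ)) (X i : MvPolynomial (Fin 2) ℚ)
  have h := (IsSemialgebraicFunOn.sub_holds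
    (isSemialgebraicFunOn_const_of_isAlgebraic isSemialgebraic_univ hc) h1).isSemialgebraic_sep_neg
  convert h using 1
  ext q
  simp [sub_neg]

/-- The half-plane `{0 < v}` and the region `{u v < 1}` under the hyperbola are
`ℚ`-semialgebraic. [folklore] -/
theorem isSemialgebraic_hyperbolic :
    IsSemialgebraic ℚ {q : Fin 2 → ℝ | 0 < q 1 ∧ q 0 * q 1 < 1} := by
  have h := (isSemialgebraic_setOf_eval_lt (k := ℚ) (R := ℝ) (ι := Fin 2) (C 0) (X 1)).inter
    (isSemialgebraic_setOf_eval_lt (k := ℚ) (R := ℝ) (ι := Fin 2) (X 0 * X 1) (C 1))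
  have hEq : {q : Fin 2 → ℝ | 0 < q 1 ∧ q 0 * q 1 < 1} =
      {x : Fin 2 → ℝ | aeval x (C 0 : MvPolynomial (Fin 2) ℚ) < aeval x (X 1 : MvPolynomial (Fin 2) ℚ)} ∩
      {x : Fin 2 → ℝ | aeval x (X 0 * X 1 : MvPolynomial (Fin 2) ℚ) <
        aeval x (C 1 : MvPolynomial (Fin 2) ℚ)} := by
    ext q; simp
  rw [hEq]; exact h

/-- Logarithmic cells with algebraic ends are `ℚ`-semialgebraic. [folklore] -/
theorem isSemialgebraic_logCell {lo hi : ℝ} (hlo : IsAlgebraic ℚ lo) (hhi : IsAlgebraic ℚ hi) :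
    IsSemialgebraic ℚ {q : Fin 2 → ℝ | lo < q 0 ∧ q 0 < hi ∧ 0 < q 1 ∧ q 0 * q 1 < 1} := by
  have h := ((isSemialgebraic_lt_apply_of_isAlgebraic hlo 0).inter
    (isSemialgebraic_apply_lt_of_isAlgebraic hhi 0)).inter isSemialgebraic_hyperbolic
  convert h using 1
  ext q
  simp [and_assoc]

/-- Points with `lo ≤ u ≤ hi`, `0 < v`, `uv < 1` (`lo > 0`) lie in the compact box
`[lo, hi] × [0, 1/lo]`. [folklore] -/
theorem mem_Icc_of_hyperbolic {lo hi : ℝ} (hlo : 0 < lo) {q : Fin 2 → ℝ} (h0 : lo ≤ q 0)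
    (h1 : q 0 ≤ hi) (h2 : 0 < q 1) (h3 : q 0 * q 1 < 1) : q ∈ Icc ![lo, 0] ![hi, lo⁻¹] := by
  have hq1 : q 1 ≤ lo⁻¹ := by
    rw [← one_div, le_div_iff₀ hlo]
    nlinarith
  refine ⟨fun i => ?_, fun i => ?_⟩ <;> fin_cases i <;> simp
  · exact h0
  · exact h2.le
  · exact h1
  · exact hq1

/-- Logarithmic cells with `0 < lo` lie in a compact box. [folklore] -/
theorem logCell_subset_Icc {lo hi : ℝ} (hlo : 0 < lo) :
    {q : Fin 2 → ℝ | lo < q 0 ∧ q 0 < hi ∧ 0 < q 1 ∧ q 0 * q 1 < 1} ⊆ Icc ![lo, 0] ![hi, lo⁻¹] := fun _ hq =>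
  mem_Icc_of_hyperbolic hlo hq.1.le hq.2.1.le hq.2.2.1 hq.2.2.2

/-- Logarithmic cells with `0 < lo` have finite area. [folklore] -/
theorem volume_logCell_ne_top {lo hi : ℝ} (hlo : 0 < lo) :
    volume {q : Fin 2 → ℝ | lo < q 0 ∧ q 0 < hi ∧ 0 < q 1 ∧ q 0 * q 1 < 1} ≠ ⊤ :=
  ((measure_mono (logCell_subset_Icc hlo)).trans_lt isCompact_Icc.measure_lt_top).ne

/-- An integrand-`1` representation on a logarithmic cell with algebraic ends `0 < lo`. [folklore] -/
theorem exists_logCellRep {lo hi : ℝ} (hlo : IsAlgebraic ℚ lo) (hhi : IsAlgebraic ℚ hi) (h0 : 0 < lo) :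
    ∃ r : KZ.IntegralRep 2, r.domain = {q : Fin 2 → ℝ | lo < q 0 ∧ q 0 < hi ∧ 0 < q 1 ∧ q 0 * q 1 < 1} ∧
      r.integrand = fun _ => 1 :=
  KZ.exists_oneRep (isSemialgebraic_logCell hlo hhi) (volume_logCell_ne_top h0)

/-! ## Membership patterns in the planar group -/

/-- A planar instance of rule (1a) lies in the planar group. [folklore] -/
theorem mem_planarGroup_of_cut {r r₁ r₂ : KZ.IntegralRep 2}
    (hr : ∀ p ∈ r.domain, r.integrand p = 1) (hr₁ : ∀ p ∈ r₁.domain, r₁.integrand p = 1)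
    (hr₂ : ∀ p ∈ r₂.domain, r₂.integrand p = 1)
    (hunion : r.domain = r₁.domain ∪ r₂.domain) (hnull : volume (r₁.domain ∩ r₂.domain) = 0) :
    KZ.of r - KZ.of r₁ - KZ.of r₂ ∈ planarGroup := by
  refine AddSubgroup.subset_closure ⟨Or.inl ⟨2, r, r₁, r₂, hunion, hnull,
    fun p hp => by rw [hr p (hunion ▸ Or.inl hp), hr₁ p hp],
    fun p hp => by rw [hr p (hunion ▸ Or.inr hp), hr₂ p hp], rfl⟩, ?_⟩
  exact (AddSubgroup.closure planarGens).sub_mem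
    ((AddSubgroup.closure planarGens).sub_mem (AddSubgroup.subset_closure ⟨r, hr, rfl⟩)
      (AddSubgroup.subset_closure ⟨r₁, hr₁, rfl⟩)) (AddSubgroup.subset_closure ⟨r₂, hr₂, rfl⟩)

/-- A planar instance of rule (2) lies in the planar group. [folklore] -/
theorem mem_planarGroup_of_cov {r r' : KZ.IntegralRep 2}
    (hr : ∀ p ∈ r.domain, r.integrand p = 1) (hr' : ∀ p ∈ r'.domain, r'.integrand p = 1)
    (h : KZ.of r - KZ.of r' ∈ KZ.changeOfVariablesRel) : KZ.of r - KZ.of r' ∈ planarGroup :=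
  AddSubgroup.subset_closure ⟨Or.inr h, (AddSubgroup.closure planarGens).sub_mem
    (AddSubgroup.subset_closure ⟨r, hr, rfl⟩) (AddSubgroup.subset_closure ⟨r', hr', rfl⟩)⟩

/-! ## The hyperbolic dilation `(u, v) ↦ (u / a, a v)` -/

/-- Coordinate projections of the plane as continuous linear forms (local notation). -/
local notation "lpr" => ContinuousLinearMap.proj (R := ℝ) (φ := fun _ : Fin 2 => ℝ)

/-- The hyperbolic dilation `D_a (u, v) = (u / a, a v)` as a continuous linear map (local
notation, no definition is introduced). -/
local notation "hypDil[" a "]" =>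
  (ContinuousLinearMap.pi ![a⁻¹ • lpr 0, a • lpr 1] : (Fin 2 → ℝ) →L[ℝ] (Fin 2 → ℝ))

/-- The hyperbolic dilation in coordinates. [folklore] -/
theorem hypDil_apply (a : ℝ) (q : Fin 2 → ℝ) : hypDil[a] q = ![a⁻¹ * q 0, a * q 1] := by
  ext i
  fin_cases i <;> simp

/-- The hyperbolic dilation has determinant `1` (for `a ≠ 0`). [folklore] -/
theorem det_hypDil {a : ℝ} (ha : a ≠ 0) : (hypDil[a]).det = 1 := by
  have h : (hypDil[a] : (Fin 2 → ℝ) →ₗ[ℝ] (Fin 2 → ℝ)) = Matrix.toLin' !![a⁻¹, 0; 0, a] := by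
    apply LinearMap.ext
    intro v
    rw [ContinuousLinearMap.coe_coe, hypDil_apply, Matrix.toLin'_apply]
    ext i
    fin_cases i <;> simp [Matrix.mulVec, dotProduct, Fin.sum_univ_two]
  rw [ContinuousLinearMap.det, h, LinearMap.det_toLin', Matrix.det_fin_two]
  simp [ha]

/-- The hyperbolic dilation with algebraic parameter is a `ℚ`-semialgebraic map. [folklore] -/
theorem isSemialgebraicMapOn_hypDil {a : ℝ} (ha : IsAlgebraic ℚ a) {s : Set (Fin 2 → ℝ)}
    (hs : IsSemialgebraic ℚ s) : IsSemialgebraicMapOn ℚ s (hypDil[a]) := by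
  refine IsSemialgebraicMapOn.of_forall hs (Fin.forall_fin_two.mpr ⟨?_, ?_⟩)
  · have h := IsSemialgebraicFunOn.mul_holds (isSemialgebraicFunOn_const_of_isAlgebraic hs ha.inv)
      (isSemialgebraicFunOn_aeval hs (X 0 : MvPolynomial (Fin 2) ℚ))
    exact h.congr fun q _ => by simp [hypDil_apply]
  · have h := IsSemialgebraicFunOn.mul_holds (isSemialgebraicFunOn_const_of_isAlgebraic hs ha)
      (isSemialgebraicFunOn_aeval hs (X 1 : MvPolynomial (Fin 2) ℚ))
    exact h.congr fun q _ => by simp [hypDil_apply]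

/-- The hyperbolic dilation is injective (for `a ≠ 0`). [folklore] -/
theorem injective_hypDil {a : ℝ} (ha : a ≠ 0) : Function.Injective (hypDil[a]) := by
  intro p q h
  rw [hypDil_apply, hypDil_apply] at h
  have h0 := congrFun h 0
  have h1 := congrFun h 1
  simp only [Matrix.cons_val_zero, Matrix.cons_val_one] at h0 h1
  ext i
  fin_cases i
  · simpa [ha] using h0
  · simpa [ha] using h1

/-- The hyperbolic dilation `D_a` carries `L(a, ab)` onto `L(1, b)` (for `0 < a`). [folklore] -/
theorem image_hypDil_logCell {a b : ℝ} (ha : 0 < a) :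
    hypDil[a] '' {q : Fin 2 → ℝ | a < q 0 ∧ q 0 < a * b ∧ 0 < q 1 ∧ q 0 * q 1 < 1} =
      {q : Fin 2 → ℝ | 1 < q 0 ∧ q 0 < b ∧ 0 < q 1 ∧ q 0 * q 1 < 1} := by
  have ha0 : a ≠ 0 := ha.ne'
  ext q
  simp only [mem_image, mem_setOf_eq]
  constructor
  · rintro ⟨p, ⟨h0, h1, h2, h3⟩, rfl⟩
    rw [hypDil_apply]
    simp only [Matrix.cons_val_zero, Matrix.cons_val_one]
    refine ⟨?_, ?_, by positivity, ?_⟩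
    · rwa [lt_inv_mul_iff₀ ha, mul_one]
    · rw [inv_mul_lt_iff₀ ha]; exact h1
    · calc a⁻¹ * p 0 * (a * p 1) = p 0 * p 1 := by field_simp
        _ < 1 := h3
  · rintro ⟨h0, h1, h2, h3⟩
    refine ⟨![a * q 0, a⁻¹ * q 1], ⟨?_, ?_, ?_, ?_⟩, ?_⟩
    · simpa using (lt_mul_iff_one_lt_right ha).mpr h0
    · simpa using mul_lt_mul_of_pos_left h1 ha
    · simp; positivity
    · simp
      calc a * q 0 * (a⁻¹ * q 1) = q 0 * q 1 := by field_simp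
        _ < 1 := h3
    · rw [hypDil_apply]
      ext i
      fin_cases i <;> simp [ha0]

/-! ## The law -/

/-- **Stub 3a (rung 0 of the normal form): the group law of logarithmic cells is planar.** For
real algebraic `a, b > 1` and planar sets `ra`, `rb`, `rab` on the logarithmic cells `L(a)`,
`L(b)`, `L(ab)` (`L(x) = {1 < u < x, 0 < v, uv < 1}`, area `log x`):
`[L(ab)] − [L(a)] − [L(b)] ∈ planarGroup` — one cut at `u = a` (rule 1a, null segment) and the
hyperbolic dilation `(u, v) ↦ (u/a, av)` (rule 2, `det = 1`). [folklore] -/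
theorem stub_logCellLaw :
    ∀ (a b : ℝ), IsAlgebraic ℚ a → IsAlgebraic ℚ b → 1 < a → 1 < b →
      ∀ (ra rb rab : KZ.IntegralRep 2),
        ra.domain = {q : Fin 2 → ℝ | 1 < q 0 ∧ q 0 < a ∧ 0 < q 1 ∧ q 0 * q 1 < 1} →
        rb.domain = {q : Fin 2 → ℝ | 1 < q 0 ∧ q 0 < b ∧ 0 < q 1 ∧ q 0 * q 1 < 1} →
        rab.domain = {q : Fin 2 → ℝ | 1 < q 0 ∧ q 0 < a * b ∧ 0 < q 1 ∧ q 0 * q 1 < 1} →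
        (∀ p ∈ ra.domain, ra.integrand p = 1) → (∀ p ∈ rb.domain, rb.integrand p = 1) →
        (∀ p ∈ rab.domain, rab.integrand p = 1) →
        KZ.of rab - KZ.of ra - KZ.of rb ∈ planarGroup := by
  intro a b ha hb h1a h1b ra rb rab hra hrb hrab hra1 hrb1 hrab1
  have ha0 : 0 < a := one_pos.trans h1a
  have hane : a ≠ 0 := ha0.ne'
  have hab : IsAlgebraic ℚ (a * b) := ha.mul hb
  have haab : a < a * b := (lt_mul_iff_one_lt_right ha0).mpr h1b
  -- V = L(a, ab), the open right piece
  obtain ⟨V, hVd, hVi⟩ := exists_logCellRep ha hab ha0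
  have hVi' : ∀ p ∈ V.domain, V.integrand p = 1 := fun p _ => by rw [hVi]
  -- N = the null segment {u = a, 0 < v, uv < 1}
  have hNsa : IsSemialgebraic ℚ {q : Fin 2 → ℝ | q 0 = a ∧ 0 < q 1 ∧ q 0 * q 1 < 1} := by
    have h := (isSemialgebraic_setOf_apply_eq_of_isAlgebraic ha (0 : Fin 2)).inter
      isSemialgebraic_hyperbolic
    convert h using 1
    ext q; simp
  have hNnull : volume {q : Fin 2 → ℝ | q 0 = a ∧ 0 < q 1 ∧ q 0 * q 1 < 1} = 0 := by
    refine measure_mono_null (fun q hq => ?_)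
      (show volume (Set.pi univ (![{a}, univ] : Fin 2 → Set ℝ)) = 0 from ?_)
    · rw [mem_univ_pi]
      intro i
      fin_cases i
      · simpa using hq.1
      · simp
    · rw [volume_pi_pi]
      simp [Fin.prod_univ_two]
  obtain ⟨N, hNd, hNi⟩ := KZ.exists_oneRep hNsa (by rw [hNnull]; exact ENNReal.zero_ne_top)
  have hNi' : ∀ p ∈ N.domain, N.integrand p = 1 := fun p _ => by rw [hNi]
  -- U = {a ≤ u < ab, 0 < v, uv < 1} = N ∪ V
  have hUsa : IsSemialgebraic ℚ {q : Fin 2 → ℝ | a ≤ q 0 ∧ q 0 < a * b ∧ 0 < q 1 ∧ q 0 * q 1 < 1} := by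
    have h1 : IsSemialgebraicFunOn ℚ (univ : Set (Fin 2 → ℝ)) (fun q => q 0) := by
      simpa using isSemialgebraicFunOn_aeval (isSemialgebraic_univ (k := ℚ))
        (X 0 : MvPolynomial (Fin 2) ℚ)
    have hge := (IsSemialgebraicFunOn.sub_holds h1
      (isSemialgebraicFunOn_const_of_isAlgebraic isSemialgebraic_univ ha)).isSemialgebraic_sep_nonneg
    have h := (hge.inter (isSemialgebraic_apply_lt_of_isAlgebraic hab 0)).inter
      isSemialgebraic_hyperbolic
    convert h using 1
    ext q
    simp [sub_nonneg, and_assoc]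
  have hUfin : volume {q : Fin 2 → ℝ | a ≤ q 0 ∧ q 0 < a * b ∧ 0 < q 1 ∧ q 0 * q 1 < 1} ≠ ⊤ :=
    ((measure_mono fun q hq => mem_Icc_of_hyperbolic ha0 hq.1 hq.2.1.le hq.2.2.1
      hq.2.2.2).trans_lt isCompact_Icc.measure_lt_top).ne
  obtain ⟨U, hUd, hUi⟩ := KZ.exists_oneRep hUsa hUfin
  have hUi' : ∀ p ∈ U.domain, U.integrand p = 1 := fun p _ => by rw [hUi]
  -- (1) cut L(ab) at u = a
  have h1 : KZ.of rab - KZ.of ra - KZ.of U ∈ planarGroup := by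
    refine mem_planarGroup_of_cut hrab1 hra1 hUi' ?_ ?_
    · rw [hrab, hra, hUd]
      ext q
      simp only [mem_setOf_eq, mem_union]
      constructor
      · rintro ⟨hq1, hq2, hq3, hq4⟩
        rcases lt_or_ge (q 0) a with h | h
        · exact Or.inl ⟨hq1, h, hq3, hq4⟩
        · exact Or.inr ⟨h, hq2, hq3, hq4⟩
      · rintro (⟨hq1, hq2, hq3, hq4⟩ | ⟨hq1, hq2, hq3, hq4⟩)
        · exact ⟨hq1, hq2.trans haab, hq3, hq4⟩
        · exact ⟨h1a.trans_le hq1, hq2, hq3, hq4⟩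
    · rw [hra, hUd]
      have he : {q : Fin 2 → ℝ | 1 < q 0 ∧ q 0 < a ∧ 0 < q 1 ∧ q 0 * q 1 < 1} ∩
          {q | a ≤ q 0 ∧ q 0 < a * b ∧ 0 < q 1 ∧ q 0 * q 1 < 1} = ∅ := by
        ext q
        simp only [mem_inter_iff, mem_setOf_eq, mem_empty_iff_false, iff_false]
        rintro ⟨⟨-, h, -, -⟩, h', -, -, -⟩
        linarith
      rw [he, measure_empty]
  -- (2) U = N ∪ V
  have h2 : KZ.of U - KZ.of N - KZ.of V ∈ planarGroup := by
    refine mem_planarGroup_of_cut hUi' hNi' hVi' ?_ ?_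
    · rw [hUd, hNd, hVd]
      ext q
      simp only [mem_setOf_eq, mem_union, mem_setOf_eq]
      constructor
      · rintro ⟨hq1, hq2, hq3, hq4⟩
        rcases hq1.lt_or_eq with h | h
        · exact Or.inr ⟨h, hq2, hq3, hq4⟩
        · exact Or.inl ⟨h.symm, hq3, hq4⟩
      · rintro (⟨hq1, hq3, hq4⟩ | ⟨hq1, hq2, hq3, hq4⟩)
        · exact ⟨hq1.ge, hq1 ▸ haab, hq3, hq4⟩
        · exact ⟨hq1.le, hq2, hq3, hq4⟩
    · rw [hNd, hVd]
      have he : {q : Fin 2 → ℝ | q 0 = a ∧ 0 < q 1 ∧ q 0 * q 1 < 1} ∩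
          {q : Fin 2 → ℝ | a < q 0 ∧ q 0 < a * b ∧ 0 < q 1 ∧ q 0 * q 1 < 1} = ∅ := by
        ext q
        simp only [mem_inter_iff, mem_setOf_eq, mem_setOf_eq, mem_empty_iff_false, iff_false]
        rintro ⟨⟨h, -, -⟩, h', -, -, -⟩
        linarith
      rw [he, measure_empty]
  -- (3) N is null
  have h3 : KZ.of N ∈ planarGroup :=
    of_mem_planarGroup_of_volume_eq_zero N hNi' (by rw [hNd, hNnull])
  -- (4) the hyperbolic dilation carries V onto L(b) = rb.domain
  have h4 : KZ.of V - KZ.of rb ∈ planarGroup := by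
    refine mem_planarGroup_of_cov hVi' hrb1 ⟨2, V, rb, hypDil[a], fun _ => hypDil[a],
      hVd ▸ isSemialgebraicMapOn_hypDil ha (isSemialgebraic_logCell ha hab),
      fun x _ => (hypDil[a]).hasFDerivAt.hasFDerivWithinAt, (injective_hypDil hane).injOn, ?_,
      fun x hx => ?_, rfl⟩
    · rw [hVd, image_hypDil_logCell ha0, hrb]
    · rw [hVi' x hx, hrb1 _ ?_, det_hypDil hane]
      · simp
      · rw [hrb]
        have hx' : x ∈ {q : Fin 2 → ℝ | a < q 0 ∧ q 0 < a * b ∧ 0 < q 1 ∧ q 0 * q 1 < 1} := hVd ▸ hx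
        have := (image_hypDil_logCell (b := b) ha0).le (mem_image_of_mem _ hx')
        exact this
  -- assemble
  have h12 := planarGroup.add_mem (planarGroup.add_mem (planarGroup.add_mem h1 h2) h3) h4
  convert h12 using 1
  abel

end Summit.KontsevichZagierPeriods.SymplecticScissors.MordellWeil

end
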